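import Summits.Ventures.PercRepro.C041StarBoundsTail

/-!
# THE SORTED CHAIN FOR `n` LEAVES: `n (1 − A)² ≤ (P₁ + n − 1)(P₂ − 1)` (mine-3, gen 65; C-041.md §21 (az))

The sorted Cauchy–Schwarz route of C041StarBoundsTail, without the threshold `P₁ ≥ 16`: for a monotone sequence of `n ≥ 1` leaves
in `[0, 1]`, `n (U − 1) ≤ P₁ − 1` (`succ_mul_sum_prefix_sq_le`) and `(1 − A)² ≤ (P₂ − 1) U`, so
`n (1 − A)² ≤ (P₁ + n − 1)(P₂ − 1)` (`chain_sorted`); sorting gives it for every star (`card_mul_sq_one_sub_prod_le`), and for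
`n ≥ 5` leaves `5 (1 − A)² ≤ (P₁ + 4)(P₂ − 1)` (`five_mul_sq_one_sub_prod_le`) — the hyperbola of the tail below `P₁ = 16`
(C041SeedCoverTailTen).
-/

namespace PercRepro

namespace TreeClosure

open Finset

/-- For a monotone sequence of `n ≥ 1` leaves in `[0, 1]`: `n (1 − A)² ≤ (P₁ + n − 1)(P₂ − 1)`. -/
theorem chain_sorted (a : ℕ → ℝ) (n : ℕ) (ha : ∀ i, 0 ≤ a i ∧ a i ≤ 1) (hmono : Monotone a) (hn : 1 ≤ n) :
    (n : ℝ) * (1 - ∏ j ∈ range n, a j) ^ 2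
      ≤ (∏ j ∈ range n, (1 + a j ^ 2) + n - 1) * (∏ j ∈ range n, (1 + (1 - a j) ^ 2) - 1) := by
  obtain ⟨n', rfl⟩ : ∃ n', n = n' + 1 := ⟨n - 1, by omega⟩
  have hS := succ_mul_sum_prefix_sq_le a n' (fun i => (ha i).1) hmono
  have hT := one_sub_prod_range_eq_sum a (n' + 1)
  have hCS := sum_mul_sq_le_sq_mul_sq (range (n' + 1)) (fun i => 1 - a i) (fun i => ∏ j ∈ range i, a j)
  have hB := sum_sq_le_prod_one_add_sq_sub_one (fun i => 1 - a i) (n' + 1)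
  have hU0 : 0 ≤ ∑ i ∈ range (n' + 1), (∏ j ∈ range i, a j) ^ 2 := sum_nonneg (fun i _ => sq_nonneg _)
  have hb0 : 0 ≤ ∑ i ∈ range (n' + 1), (1 - a i) ^ 2 := sum_nonneg (fun i _ => sq_nonneg _)
  have hP2 : 0 ≤ ∏ j ∈ range (n' + 1), (1 + (1 - a j) ^ 2) - 1 := by
    have := one_le_prod (s := range (n' + 1)) (f := fun j => 1 + (1 - a j) ^ 2) (fun j _ => by nlinarith [sq_nonneg (1 - a j)])
    linarith
  have hP1 : 1 ≤ ∏ j ∈ range (n' + 1), (1 + a j ^ 2) :=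
    one_le_prod (s := range (n' + 1)) (f := fun j => 1 + a j ^ 2) (fun j _ => by nlinarith [sq_nonneg (a j)])
  -- `U = 1 + S` with `(n' + 1) S ≤ P₁ − 1`
  have hUS : ∑ i ∈ range (n' + 1), (∏ j ∈ range i, a j) ^ 2 = 1 + ∑ i ∈ range n', (∏ j ∈ range (i + 1), a j) ^ 2 := by
    rw [sum_range_succ']
    simp only [prod_range_zero, one_pow]
    ring
  -- `(1 − A)² ≤ (Σ b²) U ≤ (P₂ − 1) U`
  have h1 : (1 - ∏ j ∈ range (n' + 1), a j) ^ 2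
      ≤ (∏ j ∈ range (n' + 1), (1 + (1 - a j) ^ 2) - 1) * ∑ i ∈ range (n' + 1), (∏ j ∈ range i, a j) ^ 2 := by
    rw [hT]
    calc (∑ i ∈ range (n' + 1), (1 - a i) * ∏ j ∈ range i, a j) ^ 2
        ≤ (∑ i ∈ range (n' + 1), (1 - a i) ^ 2) * ∑ i ∈ range (n' + 1), (∏ j ∈ range i, a j) ^ 2 := hCS
      _ ≤ (∏ j ∈ range (n' + 1), (1 + (1 - a j) ^ 2) - 1) * ∑ i ∈ range (n' + 1), (∏ j ∈ range i, a j) ^ 2 :=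
          mul_le_mul_of_nonneg_right hB hU0
  -- `(n'+1) U ≤ P₁ + n'`
  have h2 : ((n' + 1 : ℕ) : ℝ) * ∑ i ∈ range (n' + 1), (∏ j ∈ range i, a j) ^ 2 ≤ ∏ j ∈ range (n' + 1), (1 + a j ^ 2) + (n' + 1 : ℕ) - 1 := by
    rw [hUS]
    push_cast at hS ⊢
    linarith
  calc ((n' + 1 : ℕ) : ℝ) * (1 - ∏ j ∈ range (n' + 1), a j) ^ 2
      ≤ ((n' + 1 : ℕ) : ℝ) * ((∏ j ∈ range (n' + 1), (1 + (1 - a j) ^ 2) - 1) * ∑ i ∈ range (n' + 1), (∏ j ∈ range i, a j) ^ 2) :=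
        mul_le_mul_of_nonneg_left h1 (by positivity)
    _ = (∏ j ∈ range (n' + 1), (1 + (1 - a j) ^ 2) - 1) * (((n' + 1 : ℕ) : ℝ) * ∑ i ∈ range (n' + 1), (∏ j ∈ range i, a j) ^ 2) := by ring
    _ ≤ (∏ j ∈ range (n' + 1), (1 + (1 - a j) ^ 2) - 1) * (∏ j ∈ range (n' + 1), (1 + a j ^ 2) + (n' + 1 : ℕ) - 1) :=
        mul_le_mul_of_nonneg_left h2 hP2
    _ = (∏ j ∈ range (n' + 1), (1 + a j ^ 2) + (n' + 1 : ℕ) - 1) * (∏ j ∈ range (n' + 1), (1 + (1 - a j) ^ 2) - 1) := by ring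

/-- **THE CHAIN FOR EVERY STAR**: `n (1 − A)² ≤ (P₁ + n − 1)(P₂ − 1)` for `n ≥ 1` leaves (sorted by `Tuple.sort`). -/
theorem card_mul_sq_one_sub_prod_le {n : ℕ} (a : Fin n → ℝ) (ha : ∀ i, 0 ≤ a i ∧ a i ≤ 1) (hn : 1 ≤ n) :
    (n : ℝ) * (1 - ∏ i, a i) ^ 2 ≤ (∏ i, (1 + a i ^ 2) + n - 1) * (∏ i, (1 + (1 - a i) ^ 2) - 1) := by
  have hms : Monotone (a ∘ Tuple.sort a) := Tuple.monotone_sort a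
  set b : ℕ → ℝ := fun i => if h : i < n then a (Tuple.sort a ⟨i, h⟩) else 1 with hb
  have hb01 : ∀ i, 0 ≤ b i ∧ b i ≤ 1 := fun i => by
    simp only [hb]
    split_ifs with h
    · exact ha _
    · exact ⟨zero_le_one, le_rfl⟩
  have hbm : Monotone b := by
    intro i j hij
    simp only [hb]
    split_ifs with hi hj hj
    · exact hms (show (⟨i, hi⟩ : Fin n) ≤ ⟨j, hj⟩ from hij)
    · exact (ha _).2
    · omega
    · exact le_rfl
  have key : ∀ g : ℝ → ℝ, ∏ i ∈ range n, g (b i) = ∏ i, g (a i) := by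
    intro g
    rw [← Fin.prod_univ_eq_prod_range (fun i => g (b i)) n]
    have hbi : ∀ i : Fin n, g (b i) = g (a (Tuple.sort a i)) := fun i => by
      simp only [hb, i.isLt, dite_true, Fin.eta]
    simp_rw [hbi]
    exact Equiv.prod_comp (Tuple.sort a) (fun i => g (a i))
  have h1 := key (fun x => x)
  have h2 := key (fun x => 1 + x ^ 2)
  have h3 := key (fun x => 1 + (1 - x) ^ 2)
  have := chain_sorted b n hb01 hbm hn
  rw [h1, h2, h3] at this
  exact this

/-- **FIVE OR MORE LEAVES**: `5 (1 − A)² ≤ (P₁ + 4)(P₂ − 1)`. -/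
theorem five_mul_sq_one_sub_prod_le {m : ℕ} (a : Fin (m + 2) → ℝ) (ha : ∀ i, 0 ≤ a i ∧ a i ≤ 1) (h5 : 3 ≤ m) :
    5 * (1 - ∏ i, a i) ^ 2 ≤ (∏ i, (1 + a i ^ 2) + 4) * (∏ i, (1 + (1 - a i) ^ 2) - 1) := by
  have h := card_mul_sq_one_sub_prod_le a ha (by omega)
  have hP1 : 1 ≤ ∏ i, (1 + a i ^ 2) := one_le_prod (fun i _ => by nlinarith [sq_nonneg (a i)])
  have hP2 : 0 ≤ ∏ i, (1 + (1 - a i) ^ 2) - 1 := by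
    have := one_le_prod (s := univ) (f := fun i => 1 + (1 - a i) ^ 2) (fun i _ => by nlinarith [sq_nonneg (1 - a i)])
    linarith
  have hn : (5 : ℝ) ≤ ((m + 2 : ℕ) : ℝ) := by exact_mod_cast (show 5 ≤ m + 2 by omega)
  have hsq : 0 ≤ (1 - ∏ i, a i) ^ 2 := sq_nonneg _
  -- `n (1−A)² ≤ (P₁ + n − 1)(P₂ − 1)` gives `(1−A)² ≤ (P₂−1)(P₁−1)/n + (P₂−1) ≤ (P₂−1)(P₁−1)/5 + (P₂−1)`
  have hm : 0 ≤ (∏ i, (1 + a i ^ 2) - 1) * (∏ i, (1 + (1 - a i) ^ 2) - 1) := mul_nonneg (by linarith) hP2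
  nlinarith [mul_le_mul_of_nonneg_right hn hsq, mul_le_mul_of_nonneg_right hn hm]

end TreeClosure

end PercRepro
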